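import Mathlib.LinearAlgebra.Matrix.GeneralLinearGroup.Card
import Mathlib.LinearAlgebra.Matrix.CharP
import Mathlib.RingTheory.Polynomial.Cyclotomic.Roots
import Literature.NumberTheory.EllipticCurves.ThreeTorsionRadicalProofs
import Literature.NumberTheory.EllipticCurves.ThreeDivisionFieldSwanProofs
import Literature.NumberTheory.EllipticCurves.OrdinaryReductionTorsionLineProofs
import Literature.NumberTheory.EllipticCurves.LocalKummerIsotropyTransport
import Literature.NumberTheory.GaloisRepresentations.PeuRamifieCriterionProofs
import Literature.NumberTheory.GaloisRepresentations.SerreWeightEqTwoShapesProofs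
import Literature.NumberTheory.GaloisRepresentations.SerreWeightLevelOneWildTwoQProofs
import Literature.NumberTheory.GaloisRepresentations.WildInertiaTameStructure
import Literature.NumberTheory.GaloisRepresentations.ModPCyclotomicCharacterInertiaSurjective
import Literature.NumberTheory.GaloisRepresentations.FundamentalCharacterCyclotomicProofs
import Literature.NumberTheory.GaloisRepresentations.SerreSubgroupsGL2Fp
import Literature.NumberTheory.Automorphic.BCDTModularity
import HarnessLib

/-!
# `ρ̄_{E,3}` is *peu ramifié* at `3` as soon as `3 ∣ v₃(Δ)` (Conrad–Diamond–Taylor 1999, proof of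
# Thm. 7.2.1: "the splitting field is `ℚ₃(√-3, Δ^{1/3})`, which is peu-ramifié because `3 | v₃(Δ)`")

`Proofs` file (theorems only: no definition, no named fact, no instance, no `sorry`), topic
`Literature/NumberTheory/EllipticCurves`; sibling of `GoodReductionPeuRamifieProofs`,
`OrdinaryReductionPeuRamifieProofs` and `MultiplicativeReductionPeuRamifieProofs` (Serre 1987 §2.8–2.9
at a good / multiplicative `p`).  Declarations in `namespace WeierstrassCurve` are deliberate
dot-notation extensions of the Mathlib namespace, as in those siblings.

## The statement

Let `F` be a non-archimedean local field of characteristic `0` with residue field `𝔽₃` in which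
`3` is a uniformiser (e.g. `F = ℚ₃`), `E/F` an elliptic curve whose discriminant is a cube up to a
unit (`‖Δ‖ = ‖c‖³` for some `c ∈ F`; for `E/ℚ`: `3 ∣ ord₃ Δ_min`, e.g. the Kodaira types III
(`ord₃ Δ_min = 3`) and III* (`ord₃ Δ_min = 9`) of the tame quartic class, good reduction, and the
multiplicative types `I_{3n}`), and `ρ̄ : Γ_F → GL₂(𝔽₃)` a framing of `E[3]`
(`WeierstrassCurve.IsTorsionGaloisRep`).  Then `ρ̄` is *peu ramifiée* in the tree's sense
(`ModPGaloisRep.IsPeuRamifie`: the upper ramification groups `Γ_F^u`, `u > 1`, act trivially):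

* `WeierstrassCurve.isPeuRamifie_three_of_algNorm_Δ_eq_cube` (local field `F`, any `E/F`);
* `WeierstrassCurve.isPeuRamifie_restrictField_three_of_dvd_padicValInt` — for `E/ℚ` with
  `Δ_E = D ∈ ℤ`, `3 ∣ v₃(D)` (e.g. a global minimal model with `v₃(Δ_min) ∈ {0, 3, 9, 3n}`), any
  `3`-adic field `F ⊇ ℚ` with residue field `𝔽₃` and uniformiser `3`, any framing `ρ̄` of `E[3]`
  over `ℚ` and any coefficient extension `j : 𝔽₃ → k`: `(ρ̄ ⊗_j k)|Γ_F` is peu ramifiée (the shape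
  of the tree's `isPeuRamifie_restrictField_baseChange_of_hasGoodReductionAt`);
* `WeierstrassCurve.isPeuRamifie_localRestrictionAt_three_of_dvd_padicValInt` — the same at every
  local restriction datum `loc : ModPGaloisRep.LocalRestrictionAt 3 (ρ̄ ⊗_j k)`, the input shape of
  `ModPGaloisRep.serreWeight 3`;
* `WeierstrassCurve.IsTorsionGaloisRep.restrictField` — a framing of `E[n]` over `K` restricts to
  a framing of `(E⁄E')[n]` over any extension `E'/K` (torsion transfer);
* `WeierstrassCurve.serreWeight_three_eq_two_of_hasLevelOneInertiaShape_of_dvd_padicValInt` — with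
  Serre 1987 §2.8 Prop. 3 (2.8.2) (tree `serreWeight_eq_two_of_shape`): if moreover
  `ρ̄|I_F ∼ (χ *; 0 1)` (`HasLevelOneInertiaShape ι 3 _ 1 0`) then `k(ρ̄ ⊗_j k) = 2` at `loc` — the
  wild / reducible row of item W23a (Kodaira III*) is thereby reduced to the SHAPE of `ρ̄|I₃`;
* `WeierstrassCurve.serreWeight_three_eq_six_of_hasLevelOneInertiaShape_of_dvd_padicValInt` — with
  Serre 1987 §2.4 (2.4.8) (tree `serreWeightLocal_eq_two_mul_residueFieldCard`): if `ρ̄|I_F` is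
  wild of shape `(1 *; 0 χ)` (`HasLevelOneInertiaShape ι 3 _ 2 1`) then `k(ρ̄ ⊗_j k) = 6` at `loc`
  — the wild / reducible row of item W23b (Kodaira III) is reduced to the SHAPE of `ρ̄|I₃`.

This is the local input "peu ramifié" of Serre's recipe `k(ρ̄) ∈ {2, 6}` on the wildly ramified
rows of the tame quartic class at `3` (route `TameQuarticManinParity`, items W23a/W23b: Kodaira
III* ↦ `(ω *; 0 1)` peu ramifié ↦ `k = 2`, Kodaira III ↦ `(1 *; 0 ω)` peu ramifié ↦ `k = 6`).

## Source

B. Conrad, F. Diamond, R. Taylor, *Modularity of certain potentially Barsotti–Tate Galois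
representations*, J. Amer. Math. Soc. 12 (1999) 521–567 [held: `paper:doi-10-1090-s0894-0347-99-00287-8`],
§7.2, proof of Theorem 7.2.1 (p. 553): for `E/ℚ` with `27 ∤ N_E` and no quadratic twist semistable
at `3` (the tame quartic class), "To conclude strong acceptability, we need to know that if
`ρ̄|_{G₃} ≅ E[3](ℚ̄₃)` is reducible, then the splitting field is peu-ramifié.  One can compute this
splitting field to be `ℚ₃(√-3, Δ^{1/3})`, which is peu-ramifié because `3 | v₃(Δ)`, or one can see
the peu-ramifié property by using [6, Thm. 4.2.2]" (`[6]` = B. Conrad, *Finite group schemes over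
bases with low ramification*, Compositio Math. 119 (1999)).  The same mechanism is Serre's at a
multiplicative prime (Duke 54 (1987) §2.9 Prop. 5 (ii): `ℚ_p^{nr}(ζ_p, q^{1/p})` is peu ramifié iff
`p ∣ v(q)`).  The present file PROVES the statement, for every `E/F` with `‖Δ‖` a cube, from the
tree's radical description of `F(x(E[3])) = F(ζ₃, ∛Δ, R₀, R₁, R₂)` (`ThreeTorsionRadicalProofs`,
Serre 1972 §5.3 / *Abelian ℓ-adic representations* IV.1.2: `F(E[3]) ⊇ F(ζ₃, ∛Δ)`).

## Proof

If `ρ̄` is tamely ramified it is peu ramifiée (`IsTamelyRamified.isPeuRamifie`; this covers the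
irreducible level-two rows).  Otherwise some `σ₀` in the wild inertia group `P_F` acts non-trivially;
`ρ̄(P_F)` is a `3`-group (`absWildInertia_isProP_holds`), hence of order `3` in `GL₂(𝔽₃)`
(`|GL₂(𝔽₃)| = 48`), generated by the transvection `t = ρ̄(σ₀)` with fixed line `L = 𝔽₃ w₀`
(Serre 1972 §2.4, tree `Serre1972.exists_ne_zero_mulVec_eq_zero`).  As `P_F ⊴ Γ_F`, every `ρ̄(σ)`
normalises `⟨t⟩` and therefore stabilises `L`: in the basis `(w₀, w₁)` the whole of `ρ̄(Γ_F)` is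
upper triangular, `ρ̄(σ) ∼ (a_σ c_σ; 0 d_σ)`, with `a, d : Γ_F → 𝔽₃ˣ` characters, trivial on `P_F`,
and `a d = det ρ̄ = χ̄₃` (Weil pairing, `det_eq_modPCyclotomicCharacter_of_isTorsionGaloisRep_holds`).
Since `I_F / P_F` is pro-cyclic (`isCyclic_map_absInertia_of_absWildInertia_le`) and `𝔽₃ˣ × 𝔽₃ˣ`
has exponent `2`, the character `(a, d)` takes at most ONE non-trivial value on `I_F`, namely its
value at an inertia element `τ₁` with `χ̄₃(τ₁) = -1` (`ℚ₃(ζ₃)` is ramified,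
`exists_mem_absInertia_modPCyclotomicCharacterZMod_eq`), which has `a d = -1`.  Consequently
`#ρ̄(I_F) ≤ 2 · 3 = 6` and every `τ ∈ I_F` with `det ρ̄(τ) = 1` is unipotent in the basis `(w₀, w₁)`.
The criterion `ModPGaloisRep.isPeuRamifie_of_forall_exists_algNorm_le` (Serre 1987 §2.4/§2.8, tree)
then asks, for each `τ ∈ I_F` with `ρ̄(τ) ≠ 1`, for an integer `x` of `F̄` fixed by `ker ρ̄` with
`‖3‖ ≤ ‖τ x - x‖²`:
* if `det ρ̄(τ) = χ̄₃(τ) ≠ 1`, take `x = ζ₃`: `τ ζ₃ = ζ₃²` and `‖ζ₃² - ζ₃‖² = ‖1 - ζ₃‖² = ‖3‖`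
  (`algNorm_one_sub_primitiveRoot_pow`);
* if `det ρ̄(τ) = 1`, `ρ̄(τ)` is a non-trivial unipotent fixing `w₀`, and `τ` fixes `ζ₃`; take
  `x = ∛Δ / c`, a unit of `F̄` lying in `F(x(E[3]))` (`zeta_mem_and_delta_mem_xDivisionField_three`),
  hence fixed by `ker ρ̄`.  If `τ` fixed `∛Δ`, then — fixing `ζ₃`, `∛Δ` and the line `L`, i.e. one
  `x`-coordinate of `E[3]` — it would fix ALL of `R₀, R₁, R₂` (**radical rigidity**,
  `smul_radical_eq_of_smul_eq_self`: an element fixing `ζ₃, ∛Δ` changes the signs of the `R_k`, and the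
  four roots `x_ε = (-b₂ + ε₀R₀ + ε₁R₁ + ε₂R₂)/12` are permuted freely by the sign changes with
  `ε₀ε₁ε₂ = 1`), hence every `x`-coordinate of `E[3]`, so `ρ̄(τ) = ±1`, contradicting unipotence.
  So `τ ∛Δ = η ∛Δ` with `η ≠ 1` a cube root of unity and `‖τ x - x‖² = ‖η - 1‖² = ‖3‖`.

## References

* [ConradDiamondTaylor1999] B. Conrad, F. Diamond, R. Taylor, J. Amer. Math. Soc. 12 (1999),
  §7.2, proof of Thm. 7.2.1 (p. 553); Lemma 7.1.3 (p. 552); Conj. 1.2.3 (p. 524).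
* [Serre1987] J.-P. Serre, Duke Math. J. 54 (1987), §2.4 (peu/très ramifié), §2.8 Prop. 3, §2.9
  Prop. 5.
* [Serre1972] J.-P. Serre, Invent. Math. 15 (1972), §2.4 Prop. 15 (transvections and Borel
  subgroups of `GL₂(𝔽_p)`), §5.3 (`ℚ(E[3]) ⊇ ℚ(ζ₃, ∛Δ)`).
* [SerreLocalFields1979] J.-P. Serre, *Local Fields*, Ch. IV §2 Cor. 1–3 of Prop. 7 (tame
  quotient cyclic, wild inertia a `p`-group), §3 (upper numbering).
* [SilvermanAEC2009] J. H. Silverman, *The Arithmetic of Elliptic Curves*, III Ex. 3.7 (`Ψ₃`),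
  III.8 (Weil pairing: `det ρ̄ = χ̄`).
-/

noncomputable section

open scoped Classical MatrixGroups Matrix NumberField Pointwise
open Field Polynomial

universe u

/-! ## §1. `2 × 2` matrices over `𝔽₃` -/

namespace Literature.NumberTheory.EllipticCurves.ThreeTorsionPeuRamifie

open Literature.NumberTheory.GaloisRepresentations

/-- An element `g ≠ 1` of `GL₂(𝔽₃)` of `3`-power order is a transvection: `N = g - 1 ≠ 0` and
`N² = 0` (`N^{3^k} = g^{3^k} - 1 = 0` in characteristic `3`, so `tr N = det N = 0`;
Cayley–Hamilton).  [cite: Serre1972, §2.4, proof of Prop. 15] -/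
theorem sub_one_ne_zero_and_mul_self_eq_zero_of_pow_eq_one {g : GL (Fin 2) (ZMod 3)} {k : ℕ}
    (hg : g ^ 3 ^ k = 1) (hg1 : g ≠ 1) :
    (g : Matrix (Fin 2) (Fin 2) (ZMod 3)) - 1 ≠ 0 ∧
      ((g : Matrix (Fin 2) (Fin 2) (ZMod 3)) - 1) * ((g : Matrix (Fin 2) (Fin 2) (ZMod 3)) - 1)
        = 0 := by
  haveI : Fact (Nat.Prime 3) := ⟨Nat.prime_three⟩
  set N : Matrix (Fin 2) (Fin 2) (ZMod 3) := (g : Matrix (Fin 2) (Fin 2) (ZMod 3)) - 1 with hN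
  have hgp : (g : Matrix (Fin 2) (Fin 2) (ZMod 3)) ^ 3 ^ k = 1 := by
    have h' := congrArg Units.val hg
    rwa [Units.val_pow_eq_pow_val, Units.val_one] at h'
  have hNp : N ^ 3 ^ k = 0 := by
    rw [hN, sub_pow_char_pow_of_commute 3 k (Commute.one_right _), one_pow, hgp, sub_self]
  have htrN : N.trace = 0 := (Matrix.isNilpotent_trace_of_isNilpotent ⟨3 ^ k, hNp⟩).eq_zero
  have hdetN : N.det = 0 := by
    have : N.det ^ 3 ^ k = 0 := by rw [← Matrix.det_pow, hNp, Matrix.det_zero]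
    exact pow_eq_zero_iff (pow_ne_zero k three_ne_zero) |>.mp this
  refine ⟨?_, ?_⟩
  · intro h0
    exact hg1 (Units.ext (by rw [Units.val_one]; exact sub_eq_zero.mp h0))
  · rw [DeligneSerre1974.TwoByTwo.mul_self_eq N, htrN, hdetN, zero_smul, zero_smul, sub_zero]

/-- Hence such a `g` has order `3`: `g³ = (1 + N)³ = 1 + N³ = 1`. [folklore] -/
private theorem orderOf_eq_three_of_pow_eq_one {g : GL (Fin 2) (ZMod 3)} {k : ℕ}
    (hg : g ^ 3 ^ k = 1) (hg1 : g ≠ 1) : orderOf g = 3 := by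
  haveI : Fact (Nat.Prime 3) := ⟨Nat.prime_three⟩
  obtain ⟨-, hNN⟩ := sub_one_ne_zero_and_mul_self_eq_zero_of_pow_eq_one hg hg1
  refine orderOf_eq_prime ?_ hg1
  apply Units.ext
  rw [Units.val_pow_eq_pow_val, Units.val_one]
  set N : Matrix (Fin 2) (Fin 2) (ZMod 3) := (g : Matrix (Fin 2) (Fin 2) (ZMod 3)) - 1 with hN
  have hg' : (g : Matrix (Fin 2) (Fin 2) (ZMod 3)) = N + 1 := by rw [hN, sub_add_cancel]
  have hN3 : N ^ 3 = 0 := by rw [pow_succ, pow_two, hNN, zero_mul]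
  rw [hg', add_pow_char_of_commute (R := Matrix (Fin 2) (Fin 2) (ZMod 3)) 3 (Commute.one_right N),
    hN3, one_pow, zero_add]

/-- `|GL₂(𝔽₃)| = 48`. [folklore] -/
private theorem natCard_GL_two_zmod_three : Nat.card (GL (Fin 2) (ZMod 3)) = 48 := by
  rw [Matrix.card_GL_field, Fin.prod_univ_two, ZMod.card]
  norm_num

/-- A `3`-subgroup of `GL₂(𝔽₃)` has at most `3` elements (`3² ∤ 48`). [folklore] -/
private theorem natCard_le_three_of_isPGroup {H : Subgroup (GL (Fin 2) (ZMod 3))} (hH : IsPGroup 3 H) :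
    Nat.card H ≤ 3 := by
  haveI : Fact (Nat.Prime 3) := ⟨Nat.prime_three⟩
  obtain ⟨n, hn⟩ := IsPGroup.iff_card.mp hH
  have hdvd : Nat.card H ∣ 48 := natCard_GL_two_zmod_three ▸ Subgroup.card_subgroup_dvd_card H
  rw [hn] at hdvd ⊢
  match n with
  | 0 => norm_num
  | 1 => norm_num
  | (n + 2) =>
    exfalso
    have h9 : 9 ∣ 48 := (Dvd.intro_left _ (by ring : 3 ^ n * 9 = 3 ^ (n + 2))).trans hdvd
    omega

/-- In `𝔽₃ˣ × 𝔽₃ˣ` (exponent `2`) one has `u ^ 3 ^ k = u`. [folklore] -/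
private theorem units_prod_pow_three_pow (u : (ZMod 3)ˣ × (ZMod 3)ˣ) (k : ℕ) : u ^ 3 ^ k = u := by
  have hu2 : u ^ 2 = 1 := by
    haveI : Fact (Nat.Prime 3) := ⟨Nat.prime_three⟩
    obtain ⟨u₁, u₂⟩ := u
    rw [Prod.pow_mk, Prod.mk_eq_one]
    exact ⟨ZMod.units_pow_card_sub_one_eq_one 3 u₁, ZMod.units_pow_card_sub_one_eq_one 3 u₂⟩
  obtain ⟨m, hm⟩ : Odd (3 ^ k) := Odd.pow (by decide)
  rw [hm, pow_succ, pow_mul, hu2, one_pow, one_mul]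

/-- Every element of `𝔽₃ˣ × 𝔽₃ˣ` squares to `1`. [folklore] -/
private theorem units_prod_sq (u : (ZMod 3)ˣ × (ZMod 3)ˣ) : u ^ 2 = 1 := by
  haveI : Fact (Nat.Prime 3) := ⟨Nat.prime_three⟩
  obtain ⟨u₁, u₂⟩ := u
  rw [Prod.pow_mk, Prod.mk_eq_one]
  exact ⟨ZMod.units_pow_card_sub_one_eq_one 3 u₁, ZMod.units_pow_card_sub_one_eq_one 3 u₂⟩

/-- In a finite cyclic group, two non-trivial elements of order dividing `2` coincide. [folklore] -/
private theorem eq_of_sq_eq_one_of_isCyclic {C : Type*} [Group C] [Finite C] [IsCyclic C] {x y : C}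
    (hx : x ^ 2 = 1) (hy : y ^ 2 = 1) (hx1 : x ≠ 1) (hy1 : y ≠ 1) : x = y := by
  classical
  haveI := Fintype.ofFinite C
  by_contra hxy
  have hle := IsCyclic.card_pow_eq_one_le (α := C) (n := 2) two_pos
  have hsub : ({1, x, y} : Finset C) ⊆ Finset.univ.filter (fun c : C => c ^ 2 = 1) := by
    intro c hc
    simp only [Finset.mem_insert, Finset.mem_singleton] at hc
    rw [Finset.mem_filter]
    rcases hc with rfl | rfl | rfl
    · exact ⟨Finset.mem_univ _, one_pow 2⟩
    · exact ⟨Finset.mem_univ _, hx⟩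
    · exact ⟨Finset.mem_univ _, hy⟩
  have h3 : ({1, x, y} : Finset C).card = 3 :=
    Finset.card_eq_three.mpr ⟨1, x, y, hx1.symm, hy1.symm, hxy, rfl⟩
  have := (Finset.card_le_card hsub).trans hle
  omega

end Literature.NumberTheory.EllipticCurves.ThreeTorsionPeuRamifie

/-! ## §2. Framings of `E[3]` and radical rigidity (any field of characteristic `0`) -/

namespace WeierstrassCurve

open Literature.NumberTheory.EllipticCurves Literature.NumberTheory.GaloisRepresentations

section Framing

variable {K : Type u} [Field K] {W : WeierstrassCurve K} {n : ℕ}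
  {ρ : FramedGaloisRep K (ZMod n) 2}

/-- A framing is faithful on `E[n]`: `ρ̄(σ) = 1` iff `σ` fixes `E[n]` pointwise (`ρ̄_m : G_{K̄/K} →
Aut(E[m])` is the action on `E[m]`). [cite: SilvermanCSS1997, §7] [cite: SilvermanAEC2009, III.7] -/
theorem IsTorsionGaloisRep.apply_eq_one_iff' (hρ : W.IsTorsionGaloisRep n ρ)
    (σ : absoluteGaloisGroup K) : ρ σ = 1 ↔ ∀ P : geomTorsion W n, σ • P = P := by
  obtain ⟨e, he⟩ := hρ
  constructor
  · intro h P
    apply e.injective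
    rw [he σ P, h, Units.val_one, Matrix.one_mulVec]
  · intro h
    apply Units.ext
    ext i j
    have hx := he σ (e.symm (Pi.single j 1))
    rw [h, AddEquiv.apply_symm_apply] at hx
    have hij := congrFun hx i
    rw [Matrix.mulVec_single_one, Matrix.col_apply] at hij
    rw [← hij, Units.val_one, Matrix.one_apply, Pi.single_apply]

/-- If `σ` acts as `-1` on `E[n]` then `ρ̄(σ) = -1`. [cite: SilvermanCSS1997, §7] [cite: SilvermanAEC2009, III.7] -/
theorem IsTorsionGaloisRep.apply_eq_neg_one_of_forall_smul_eq_neg (hρ : W.IsTorsionGaloisRep n ρ)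
    {σ : absoluteGaloisGroup K} (h : ∀ P : geomTorsion W n, σ • P = -P) : ρ σ = -1 := by
  obtain ⟨e, he⟩ := hρ
  apply Units.ext
  rw [Units.val_neg, Units.val_one]
  ext i j
  have hx := he σ (e.symm (Pi.single j 1))
  rw [h, map_neg, AddEquiv.apply_symm_apply] at hx
  have hij := congrFun hx i
  rw [Matrix.mulVec_single_one, Matrix.col_apply] at hij
  rw [← hij, Pi.neg_apply, Matrix.neg_apply, Matrix.one_apply, Pi.single_apply]

/-- On a group killed by `3`, an automorphism acting on every element by `±1` acts by a COMMON
sign. [folklore] -/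
private theorem forall_smul_eq_or_forall_smul_eq_neg {σ : absoluteGaloisGroup K}
    (h : ∀ P : geomTorsion W 3, σ • P = P ∨ σ • P = -P) :
    (∀ P : geomTorsion W 3, σ • P = P) ∨ (∀ P : geomTorsion W 3, σ • P = -P) := by
  -- `2 P = 0 ⇒ P = 0` in `E[3]`
  have h2 : ∀ P : geomTorsion W 3, P + P = 0 → P = 0 := by
    intro P hP
    have h3 : ((3 : ℕ) : ℤ) • (P : geomPoints W) = 0 := mem_torsionBy_iff.mp P.2
    have h3' : ((3 : ℕ) : ℤ) • P = 0 := Subtype.ext (by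
      rw [AddSubgroupClass.coe_zsmul, h3]; rfl)
    have hsum : ((3 : ℕ) : ℤ) • P = (P + P) + P := by
      rw [show ((3 : ℕ) : ℤ) = 2 + 1 by norm_num, add_zsmul, one_zsmul, two_zsmul]
    rw [hsum, hP, zero_add] at h3'
    exact h3'
  by_contra hno
  rw [not_or, not_forall, not_forall] at hno
  obtain ⟨⟨P₁, hP₁⟩, ⟨P₂, hP₂⟩⟩ := hno
  have hP₁' : σ • P₁ = -P₁ := (h P₁).resolve_left hP₁
  have hP₂' : σ • P₂ = P₂ := (h P₂).resolve_right hP₂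
  rcases h (P₁ + P₂) with hp | hm
  · rw [smul_add, hP₁', hP₂'] at hp
    have h' : -P₁ = P₁ := add_right_cancel hp
    have : P₁ + P₁ = 0 := by
      nth_rewrite 1 [← h']
      exact neg_add_cancel P₁
    exact hP₁ (by rw [h2 P₁ this, smul_zero])
  · rw [smul_add, hP₁', hP₂', neg_add] at hm
    have h' : P₂ = -P₂ := add_left_cancel hm
    have : P₂ + P₂ = 0 := by
      nth_rewrite 2 [h']
      exact add_neg_cancel P₂
    exact hP₂ (by rw [h2 P₂ this, smul_zero, neg_zero])

/-- An element fixing all the `x`-coordinates of `E[3]` acts on `E[3]` as `±1` (a point of `E` is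
determined by its `x`-coordinate up to sign, and an automorphism of `E[3]` acting by `±1` on every
element is `±1`). [cite: SilvermanAEC2009, III.2.3 and III.7] -/
theorem IsTorsionGaloisRep.apply_eq_one_or_eq_neg_one_of_mem_xFixingSubgroup
    {ρ : FramedGaloisRep K (ZMod 3) 2} (hρ : W.IsTorsionGaloisRep 3 ρ) {σ : absoluteGaloisGroup K}
    (hσ : σ ∈ W.xFixingSubgroup 3) : ρ σ = 1 ∨ ρ σ = -1 := by
  have key : ∀ P : geomTorsion W 3, σ • P = P ∨ σ • P = -P := by
    intro P
    rcases hP : (P : geomPoints W) with _ | ⟨x, y, hxy⟩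
    · left
      apply Subtype.ext
      rw [AddSubgroup.torsionBy.coe_smul, hP]
      exact smul_zero σ
    · have hx : σ • x = x := (W.mem_xFixingSubgroup_iff 3).mp hσ P x y hxy hP
      have hσP : ((σ • P : geomTorsion W 3) : geomPoints W) =
          Affine.Point.map ((show AlgebraicClosure K ≃ₐ[K] AlgebraicClosure K from σ) :
            AlgebraicClosure K →ₐ[K] AlgebraicClosure K) (Affine.Point.some x y hxy) := by
        rw [AddSubgroup.torsionBy.coe_smul, hP]; rfl
      rw [Affine.Point.map_some] at hσP
      rcases W.eq_or_eq_neg_of_x_eq hP hσP hx with h | h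
      · exact Or.inl h
      · exact Or.inr h
  rcases forall_smul_eq_or_forall_smul_eq_neg key with h | h
  · exact Or.inl ((hρ.apply_eq_one_iff' σ).mpr h)
  · exact Or.inr (hρ.apply_eq_neg_one_of_forall_smul_eq_neg h)

end Framing

section Rigidity

variable {K : Type u} [Field K] [CharZero K] (W : WeierstrassCurve K) [W.IsElliptic]

/-- **Radical rigidity.**  Let `ζ, δ, R₀, R₁, R₂ ∈ K̄` be radical data for `E[3]`
(`ζ² + ζ + 1 = 0`, `δ³ = Δ`, `R_k² = c₄ - 12 ζ^k δ`, `R₀R₁R₂ = c₆`).  If `σ ∈ Γ_K` fixes `ζ` and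
`δ` and stabilises one line of `E[3]` (`σ T = ± T` for some `T ≠ 0`), then `σ` fixes
`R₀, R₁, R₂` — the sign changes `R_k ↦ ε_k R_k`, `ε₀ε₁ε₂ = 1`, permute the four roots
`x_ε = (-b₂ + ε₀R₀ + ε₁R₁ + ε₂R₂)/12` of `Ψ₃` freely (Klein four-group inside
`PGL₂(𝔽₃) ≅ 𝔖₄`; `K(ζ₃, ∛Δ)` is the fixed field of the quaternion subgroup of `GL₂(𝔽₃)`).
[cite: Serre1972, §5.3] [cite: SilvermanAEC2009, Exercise 3.7] -/
theorem smul_radical_eq_of_smul_eq_self {ζ δ R₀ R₁ R₂ : AlgebraicClosure K}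
    (hζ : ζ ^ 2 + ζ + 1 = 0) (hδ : δ ^ 3 = algebraMap K (AlgebraicClosure K) W.Δ)
    (h₀ : R₀ ^ 2 = algebraMap K (AlgebraicClosure K) W.c₄ - 12 * δ)
    (h₁ : R₁ ^ 2 = algebraMap K (AlgebraicClosure K) W.c₄ - 12 * ζ * δ)
    (h₂ : R₂ ^ 2 = algebraMap K (AlgebraicClosure K) W.c₄ - 12 * ζ ^ 2 * δ)
    (hρ : R₀ * R₁ * R₂ = algebraMap K (AlgebraicClosure K) W.c₆) {σ : absoluteGaloisGroup K}
    (hσζ : σ • ζ = ζ) (hσδ : σ • δ = δ) {T : geomTorsion W 3} (hT0 : T ≠ 0)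
    (hσT : σ • T = T ∨ σ • T = -T) : σ • R₀ = R₀ ∧ σ • R₁ = R₁ ∧ σ • R₂ = R₂ := by
  obtain ⟨-, ec₄, -, eΔ⟩ := W.baseChange_algebraicClosure_invariants
  have h2' : (2 : AlgebraicClosure K) ≠ 0 := two_ne_zero
  have h3' : (3 : AlgebraicClosure K) ≠ 0 := three_ne_zero
  have hδ0 : δ ≠ 0 := by
    intro h0
    rw [h0, zero_pow three_ne_zero, ← eΔ] at hδ
    exact ((W.baseChange (AlgebraicClosure K)).coe_Δ' ▸
      (W.baseChange (AlgebraicClosure K)).Δ'.ne_zero :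
        (W.baseChange (AlgebraicClosure K)).Δ ≠ 0) hδ.symm
  have h₀' := h₀; have h₁' := h₁; have h₂' := h₂
  rw [← ec₄] at h₀' h₁' h₂'
  obtain ⟨h01, h02, h12⟩ :=
    (W.baseChange (AlgebraicClosure K)).radical_sq_ne h2' h3' hζ hδ0 h₀' h₁' h₂'
  -- the `x`-coordinate of `T` and its radical expression
  rcases hP : (T : geomPoints W) with _ | ⟨x, y, hxy⟩
  · exact absurd (Subtype.ext hP) hT0
  obtain ⟨ε₀, ε₁, ε₂, hε₀, hε₁, hε₂, -, hx⟩ :=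
    W.radical_of_geomTorsion_three_eq_some two_ne_zero three_ne_zero hζ hδ h₀ h₁ h₂ hρ hP
  -- `σ x = x`
  have hσx : σ • x = x := by
    have hσP : ((σ • T : geomTorsion W 3) : geomPoints W) =
        Affine.Point.map ((show AlgebraicClosure K ≃ₐ[K] AlgebraicClosure K from σ) :
          AlgebraicClosure K →ₐ[K] AlgebraicClosure K) (Affine.Point.some x y hxy) := by
      rw [AddSubgroup.torsionBy.coe_smul, hP]; rfl
    rw [Affine.Point.map_some] at hσP
    rcases hσT with h | h
    · rw [h, hP] at hσP
      exact ((Affine.Point.some.injEq _ _ _ _ _ _).mp hσP).1.symm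
    · rw [h, AddSubgroup.coe_neg] at hσP
      have hneg : -(T : geomPoints W) = Affine.Point.some x
          ((W.baseChange (AlgebraicClosure K)).toAffine.negY x y)
          ((Affine.nonsingular_neg ..).mpr hxy) := by
        rw [hP]; exact Affine.Point.neg_some hxy
      rw [hneg] at hσP
      exact ((Affine.Point.some.injEq _ _ _ _ _ _).mp hσP).1.symm
  -- `σ R_k = ± R_k`
  have hb₂ : σ • algebraMap K (AlgebraicClosure K) W.b₂ = algebraMap K (AlgebraicClosure K) W.b₂ :=
    smul_algebraMap σ W.b₂
  have hc₄ : σ • algebraMap K (AlgebraicClosure K) W.c₄ = algebraMap K (AlgebraicClosure K) W.c₄ :=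
    smul_algebraMap σ W.c₄
  have hc₆ : σ • algebraMap K (AlgebraicClosure K) W.c₆ = algebraMap K (AlgebraicClosure K) W.c₆ :=
    smul_algebraMap σ W.c₆
  have hnum : ∀ m : ℕ, σ • ((m : AlgebraicClosure K)) = m := fun m ↦ by
    rw [show ((m : AlgebraicClosure K)) = algebraMap K (AlgebraicClosure K) m from
      (map_natCast _ m).symm]
    exact smul_algebraMap σ (m : K)
  have h12σ : σ • (12 : AlgebraicClosure K) = 12 := by exact_mod_cast hnum 12
  have sign : ∀ {R c : AlgebraicClosure K}, R ^ 2 = c → σ • c = c → σ • R = R ∨ σ • R = -R := by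
    intro R c hR hc
    have : (σ • R) ^ 2 = R ^ 2 := by rw [← smul_pow', hR, hc]
    exact sq_eq_sq_iff_eq_or_eq_neg.mp this
  have s₀ := sign h₀ (by rw [smul_sub, hc₄, smul_mul', h12σ, hσδ])
  have s₁ := sign h₁ (by rw [smul_sub, hc₄, smul_mul', smul_mul', h12σ, hσζ, hσδ])
  have s₂ := sign h₂ (by rw [smul_sub, hc₄, smul_mul', smul_mul', h12σ, smul_pow', hσζ, hσδ])
  -- the signs `ε_k`
  have hεσ : ∀ ε : AlgebraicClosure K, (ε = 1 ∨ ε = -1) → σ • ε = ε := by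
    rintro ε (rfl | rfl)
    · exact smul_one σ
    · rw [smul_neg, smul_one]
  have sqε : ∀ ε : AlgebraicClosure K, (ε = 1 ∨ ε = -1) → ε ^ 2 = 1 := by
    rintro ε (rfl | rfl) <;> norm_num
  -- apply `σ` to `12 x = -b₂ + ε₀R₀ + ε₁R₁ + ε₂R₂`
  have hx' : 12 * x = -algebraMap K (AlgebraicClosure K) W.b₂ + ε₀ * (σ • R₀) + ε₁ * (σ • R₁) +
      ε₂ * (σ • R₂) := by
    have := congrArg (σ • ·) hx
    simp only [smul_mul', h12σ, hσx, smul_add, smul_neg, hb₂, hεσ _ hε₀, hεσ _ hε₁, hεσ _ hε₂]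
      at this
    exact this
  -- (E1): `ε₀ (σR₀ - R₀) + ε₁ (σR₁ - R₁) + ε₂ (σR₂ - R₂) = 0`
  have E1 : ε₀ * (σ • R₀ - R₀) + ε₁ * (σ • R₁ - R₁) + ε₂ * (σ • R₂ - R₂) = 0 := by
    linear_combination hx - hx'
  have e₀ := sqε _ hε₀; have e₁ := sqε _ hε₁; have e₂ := sqε _ hε₂
  -- `R₀R₁R₂ = c₆` is fixed
  have hprod : (σ • R₀) * (σ • R₁) * (σ • R₂) = R₀ * R₁ * R₂ := by
    rw [← smul_mul', ← smul_mul', hρ, hc₆]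
  -- case analysis on the three signs
  rcases s₀ with t₀ | t₀ <;> rcases s₁ with t₁ | t₁ <;> rcases s₂ with t₂ | t₂
  · exact ⟨t₀, t₁, t₂⟩
  · -- (+,+,-): `R₂ = 0`
    refine ⟨t₀, t₁, ?_⟩
    have : ε₂ * (2 * R₂) = 0 := by linear_combination (-1 : AlgebraicClosure K) * E1 + ε₀ * t₀ + ε₁ * t₁ + ε₂ * t₂
    have hR : R₂ = 0 := by
      rcases mul_eq_zero.mp this with h | h
      · rw [h, zero_pow two_ne_zero] at e₂; exact absurd e₂ zero_ne_one
      · exact (mul_eq_zero.mp h).resolve_left h2'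
    rw [t₂, hR, neg_zero]
  · -- (+,-,+): `R₁ = 0`
    refine ⟨t₀, ?_, t₂⟩
    have : ε₁ * (2 * R₁) = 0 := by linear_combination (-1 : AlgebraicClosure K) * E1 + ε₀ * t₀ + ε₁ * t₁ + ε₂ * t₂
    have hR : R₁ = 0 := by
      rcases mul_eq_zero.mp this with h | h
      · rw [h, zero_pow two_ne_zero] at e₁; exact absurd e₁ zero_ne_one
      · exact (mul_eq_zero.mp h).resolve_left h2'
    rw [t₁, hR, neg_zero]
  · -- (+,-,-): `ε₁R₁ + ε₂R₂ = 0 ⇒ R₁² = R₂²`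
    exfalso
    have h' : ε₁ * R₁ + ε₂ * R₂ = 0 := by
      have : 2 * (ε₁ * R₁ + ε₂ * R₂) = 0 := by
        linear_combination (-1 : AlgebraicClosure K) * E1 + ε₀ * t₀ + ε₁ * t₁ + ε₂ * t₂
      exact (mul_eq_zero.mp this).resolve_left h2'
    apply h12
    have : (ε₁ * R₁) ^ 2 = (ε₂ * R₂) ^ 2 := by
      rw [show ε₁ * R₁ = -(ε₂ * R₂) by linear_combination h', neg_sq]
    rw [mul_pow, mul_pow, e₁, e₂, one_mul, one_mul] at this
    exact this
  · -- (-,+,+): `R₀ = 0`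
    refine ⟨?_, t₁, t₂⟩
    have : ε₀ * (2 * R₀) = 0 := by linear_combination (-1 : AlgebraicClosure K) * E1 + ε₀ * t₀ + ε₁ * t₁ + ε₂ * t₂
    have hR : R₀ = 0 := by
      rcases mul_eq_zero.mp this with h | h
      · rw [h, zero_pow two_ne_zero] at e₀; exact absurd e₀ zero_ne_one
      · exact (mul_eq_zero.mp h).resolve_left h2'
    rw [t₀, hR, neg_zero]
  · -- (-,+,-): `R₀² = R₂²`
    exfalso
    have h' : ε₀ * R₀ + ε₂ * R₂ = 0 := by
      have : 2 * (ε₀ * R₀ + ε₂ * R₂) = 0 := by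
        linear_combination (-1 : AlgebraicClosure K) * E1 + ε₀ * t₀ + ε₁ * t₁ + ε₂ * t₂
      exact (mul_eq_zero.mp this).resolve_left h2'
    apply h02
    have : (ε₀ * R₀) ^ 2 = (ε₂ * R₂) ^ 2 := by
      rw [show ε₀ * R₀ = -(ε₂ * R₂) by linear_combination h', neg_sq]
    rw [mul_pow, mul_pow, e₀, e₂, one_mul, one_mul] at this
    exact this
  · -- (-,-,+): `R₀² = R₁²`
    exfalso
    have h' : ε₀ * R₀ + ε₁ * R₁ = 0 := by
      have : 2 * (ε₀ * R₀ + ε₁ * R₁) = 0 := by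
        linear_combination (-1 : AlgebraicClosure K) * E1 + ε₀ * t₀ + ε₁ * t₁ + ε₂ * t₂
      exact (mul_eq_zero.mp this).resolve_left h2'
    apply h01
    have : (ε₀ * R₀) ^ 2 = (ε₁ * R₁) ^ 2 := by
      rw [show ε₀ * R₀ = -(ε₁ * R₁) by linear_combination h', neg_sq]
    rw [mul_pow, mul_pow, e₀, e₁, one_mul, one_mul] at this
    exact this
  · -- (-,-,-): `c₆ = -c₆`, so some `R_k = 0`, then two of the others have equal squares
    exfalso
    have hzero : R₀ * R₁ * R₂ = 0 := by
      have : 2 * (R₀ * R₁ * R₂) = 0 := by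
        rw [t₀, t₁, t₂] at hprod
        linear_combination -hprod
      exact (mul_eq_zero.mp this).resolve_left h2'
    have E2 : ε₀ * R₀ + ε₁ * R₁ + ε₂ * R₂ = 0 := by
      have : 2 * (ε₀ * R₀ + ε₁ * R₁ + ε₂ * R₂) = 0 := by
        linear_combination (-1 : AlgebraicClosure K) * E1 + ε₀ * t₀ + ε₁ * t₁ + ε₂ * t₂
      exact (mul_eq_zero.mp this).resolve_left h2'
    rcases mul_eq_zero.mp hzero with h | h
    · rcases mul_eq_zero.mp h with h | h
      · -- `R₀ = 0`: `R₁² = R₂²`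
        apply h12
        have : (ε₁ * R₁) ^ 2 = (ε₂ * R₂) ^ 2 := by
          rw [show ε₁ * R₁ = -(ε₂ * R₂) by linear_combination E2 - ε₀ * h, neg_sq]
        rw [mul_pow, mul_pow, e₁, e₂, one_mul, one_mul] at this
        exact this
      · -- `R₁ = 0`: `R₀² = R₂²`
        apply h02
        have : (ε₀ * R₀) ^ 2 = (ε₂ * R₂) ^ 2 := by
          rw [show ε₀ * R₀ = -(ε₂ * R₂) by linear_combination E2 - ε₁ * h, neg_sq]
        rw [mul_pow, mul_pow, e₀, e₂, one_mul, one_mul] at this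
        exact this
    · -- `R₂ = 0`: `R₀² = R₁²`
      apply h01
      have : (ε₀ * R₀) ^ 2 = (ε₁ * R₁) ^ 2 := by
        rw [show ε₀ * R₀ = -(ε₁ * R₁) by linear_combination E2 - ε₂ * h, neg_sq]
      rw [mul_pow, mul_pow, e₀, e₁, one_mul, one_mul] at this
      exact this

/-- **Radical rigidity, Galois form.**  With radical data as above, an element of `Γ_K` fixing
`ζ₃`, `∛Δ` and one line of `E[3]` fixes every `x`-coordinate of `E[3]`
(`x ∈ W.xFixingSubgroup 3`), hence acts on `E[3]` as `±1`
(`IsTorsionGaloisRep.apply_eq_one_or_eq_neg_one_of_mem_xFixingSubgroup`).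
[cite: Serre1972, §5.3] [cite: SilvermanAEC2009, Exercise 3.7] -/
theorem mem_xFixingSubgroup_three_of_smul_eq_self {ζ δ R₀ R₁ R₂ : AlgebraicClosure K}
    (hζ : ζ ^ 2 + ζ + 1 = 0) (hδ : δ ^ 3 = algebraMap K (AlgebraicClosure K) W.Δ)
    (h₀ : R₀ ^ 2 = algebraMap K (AlgebraicClosure K) W.c₄ - 12 * δ)
    (h₁ : R₁ ^ 2 = algebraMap K (AlgebraicClosure K) W.c₄ - 12 * ζ * δ)
    (h₂ : R₂ ^ 2 = algebraMap K (AlgebraicClosure K) W.c₄ - 12 * ζ ^ 2 * δ)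
    (hρ : R₀ * R₁ * R₂ = algebraMap K (AlgebraicClosure K) W.c₆) {σ : absoluteGaloisGroup K}
    (hσζ : σ • ζ = ζ) (hσδ : σ • δ = δ) {T : geomTorsion W 3} (hT0 : T ≠ 0)
    (hσT : σ • T = T ∨ σ • T = -T) : σ ∈ W.xFixingSubgroup 3 :=
  (W.mem_xFixingSubgroup_three_iff_radical two_ne_zero three_ne_zero hζ hδ h₀ h₁ h₂ hρ σ).mpr
    (W.smul_radical_eq_of_smul_eq_self hζ hδ h₀ h₁ h₂ hρ hσζ hσδ hT0 hσT)

end Rigidity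

end WeierstrassCurve

/-! ## §3. Small field lemmas -/

namespace Literature.NumberTheory.EllipticCurves.ThreeTorsionPeuRamifie

open Literature.NumberTheory.GaloisRepresentations ValuativeRel
  Literature.NumberTheory.GaloisRepresentations.IsNonarchimedeanLocalField

/-- `η³ = 1`, `η ≠ 1` ⇒ `η` is a primitive cube root of unity. [folklore] -/
private theorem isPrimitiveRoot_three_of_cube_eq_one {M : Type*} [CommMonoid M] {η : M} (h3 : η ^ 3 = 1)
    (h1 : η ≠ 1) : IsPrimitiveRoot η 3 := by
  refine (IsPrimitiveRoot.iff (by norm_num : 0 < 3)).mpr ⟨h3, fun l hl hl3 ↦ ?_⟩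
  interval_cases l
  · rwa [pow_one]
  · intro h2
    apply h1
    calc η = η ^ 2 * η := by rw [h2, one_mul]
      _ = η ^ 3 := (pow_succ η 2).symm
      _ = 1 := h3

variable {F : Type u} [Field F] [ValuativeRel F] [TopologicalSpace F] [IsNonarchimedeanLocalField F]

/-- Integers prime to the residue characteristic are units: `‖m‖ = 1` in `F̄` if `‖p‖ < 1` and
`p ∤ m` (Bezout `1 = a p + b m`). [folklore] -/
private theorem algNorm_natCast_eq_one_of_not_dvd {p : ℕ} (hp : p.Prime)
    (hlt : algNorm F ((p : ℕ) : AlgebraicClosure F) < 1) {m : ℕ} (hm : ¬ p ∣ m) :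
    algNorm F ((m : ℕ) : AlgebraicClosure F) = 1 := by
  have hle : ∀ n : ℕ, algNorm F ((n : ℕ) : AlgebraicClosure F) ≤ 1 := fun n ↦ by
    rw [← map_natCast (algebraMap 𝒪[F] (AlgebraicClosure F)) n]
    exact algNorm_algebraMap_integer _
  have hleZ : ∀ n : ℤ, algNorm F ((n : ℤ) : AlgebraicClosure F) ≤ 1 := fun n ↦ by
    rw [← map_intCast (algebraMap 𝒪[F] (AlgebraicClosure F)) n]
    exact algNorm_algebraMap_integer _
  have hcop : Nat.Coprime p m := (Nat.Prime.coprime_iff_not_dvd hp).mpr hm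
  have hbez : ((Nat.gcd p m : ℕ) : ℤ) = p * Nat.gcdA p m + m * Nat.gcdB p m := Nat.gcd_eq_gcd_ab p m
  rw [Nat.Coprime.gcd_eq_one hcop] at hbez
  have hK : (1 : AlgebraicClosure F) = (p : AlgebraicClosure F) * (Nat.gcdA p m : AlgebraicClosure F) +
      (m : AlgebraicClosure F) * (Nat.gcdB p m : AlgebraicClosure F) := by
    have h := congrArg (Int.cast : ℤ → AlgebraicClosure F) hbez
    push_cast at h
    exact h
  refine le_antisymm (hle m) (not_lt.mp fun hml ↦ ?_)
  have h1 : algNorm F (1 : AlgebraicClosure F) < 1 := by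
    rw [hK]
    refine lt_of_le_of_lt (algNorm_add_le _ _) (max_lt ?_ ?_)
    · rw [algNorm_mul]
      exact mul_lt_one_of_nonneg_of_lt_one_left (algNorm_nonneg _) hlt (hleZ _)
    · rw [algNorm_mul]
      exact mul_lt_one_of_nonneg_of_lt_one_left (algNorm_nonneg _) hml (hleZ _)
  rw [algNorm_one] at h1
  exact lt_irrefl _ h1

/-- `‖n‖ = 1` in `F̄` for an integer `n` prime to the residue characteristic. [folklore] -/
private theorem algNorm_intCast_eq_one_of_not_dvd {p : ℕ} (hp : p.Prime)
    (hlt : algNorm F ((p : ℕ) : AlgebraicClosure F) < 1) {n : ℤ} (hn : ¬ (p : ℤ) ∣ n) :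
    algNorm F ((n : ℤ) : AlgebraicClosure F) = 1 := by
  have hn' : ¬ p ∣ n.natAbs := fun h ↦ hn (Int.natCast_dvd.mpr h)
  rcases Int.natAbs_eq n with h | h
  · rw [h, Int.cast_natCast]
    exact algNorm_natCast_eq_one_of_not_dvd hp hlt hn'
  · rw [h, Int.cast_neg, Int.cast_natCast, algNorm_neg]
    exact algNorm_natCast_eq_one_of_not_dvd hp hlt hn'

end Literature.NumberTheory.EllipticCurves.ThreeTorsionPeuRamifie

/-! ## §4. The local theorem and its consequences over `ℚ` -/

namespace WeierstrassCurve

open Literature.NumberTheory.EllipticCurves Literature.NumberTheory.GaloisRepresentations Field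
  ValuativeRel
  Literature.NumberTheory.GaloisRepresentations.IsNonarchimedeanLocalField
  Literature.NumberTheory.GaloisRepresentations.ModPGaloisRep
  Literature.NumberTheory.EllipticCurves.ThreeTorsionPeuRamifie

section Transfer

/-- **Restriction of a framing.**  If `ρ̄` frames `E[n]` over `K`, then `ρ̄|Γ_E` frames `(E⁄E)[n]`
over any extension `E/K` (through the torsion transfer `E[n](K̄) ≃ (E⁄E)[n](Ē)`,
`torsionTransferEquiv`): the local representation `ρ̄|Γ_{K_v}` of `ρ̄_{E,n}` is the representation
of `Γ_{K_v}` on `E[n]`. [cite: SerreAbelianLadic1968, Ch. I §2.1 and Ch. IV §1.1] -/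
theorem IsTorsionGaloisRep.restrictField {K : Type u} [Field K] [CharZero K]
    {W : WeierstrassCurve K} [W.IsElliptic] {n : ℕ} (hn : n ≠ 0)
    {ρ : FramedGaloisRep K (ZMod n) 2} (hρ : W.IsTorsionGaloisRep n ρ)
    (E : Type u) [Field E] [Algebra K E] :
    (W.baseChange E).IsTorsionGaloisRep n (FramedGaloisRep.restrictField E ρ) := by
  obtain ⟨e, he⟩ := hρ
  have hn' : ((n : ℕ) : ℤ) ≠ 0 := by exact_mod_cast hn
  refine ⟨(W.torsionTransferEquiv (E := E) hn').symm.trans e, fun σ P ↦ ?_⟩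
  rw [AddEquiv.trans_apply, AddEquiv.trans_apply, torsionTransferEquiv_symm_smul, he,
    FramedGaloisRep.restrictField_apply]

end Transfer

section Local

variable {F : Type u} [Field F] [ValuativeRel F] [TopologicalSpace F] [IsNonarchimedeanLocalField F]
  [CharZero F]

/-- **`ρ̄_{E,3}|Γ_F` is peu ramifiée when `‖Δ‖` is a cube** (`F` a `3`-adic field with residue
field `𝔽₃` and uniformiser `3`, e.g. `ℚ₃`; `E/F` any elliptic curve with `‖Δ_E‖ = ‖c‖³` for some
`c ∈ F`; `ρ̄` any framing of `E[3]`).  This is the statement "the splitting field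
`ℚ₃(√-3, Δ^{1/3})` is peu-ramifié because `3 | v₃(Δ)`" of Conrad–Diamond–Taylor, proof of
Thm. 7.2.1, proved here for every residual shape (tame, or wild `= (a *; 0 d)` by the transvection
argument of the module docstring) through the criterion `isPeuRamifie_of_forall_exists_algNorm_le`
with the Kummer witnesses `ζ₃` and `∛Δ / c`.
[cite: ConradDiamondTaylor1999, §7.2, proof of Thm. 7.2.1 (p. 553)] [cite: Serre1987, §2.4 and §2.8 Prop. 3]
[cite: Serre1972, §5.3] -/
theorem isPeuRamifie_three_of_algNorm_Δ_eq_cube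
    (hirr : Irreducible ((3 : ℕ) : 𝒪[F])) (hq : residueFieldCard F = 3)
    (V : WeierstrassCurve F) [V.IsElliptic]
    (hΔ : ∃ c : F, algNorm F (algebraMap F (AlgebraicClosure F) V.Δ) =
      algNorm F (algebraMap F (AlgebraicClosure F) c) ^ 3)
    {ρ : ModPGaloisRep F (ZMod 3) 2} (hρ : V.IsTorsionGaloisRep 3 ρ) : ρ.IsPeuRamifie := by
  classical
  haveI : NeZero ((3 : ℕ) : F) := neZero_natCast_of_irreducible hirr
  haveI : CharZero (AlgebraicClosure F) :=
    charZero_of_injective_algebraMap (algebraMap F (AlgebraicClosure F)).injective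
  have hϖ0 : ((3 : ℕ) : 𝒪[F]) ≠ 0 := hirr.ne_zero
  -- the residue characteristic of `F` is `3`
  have hp3 : ringChar 𝓀[F] = 3 := by
    have hmem : ((3 : ℕ) : 𝒪[F]) ∈ 𝓂[F] := (IsLocalRing.mem_maximalIdeal _).mpr hirr.not_isUnit
    have h0 : ((3 : ℕ) : 𝓀[F]) = 0 := by
      rw [← map_natCast (IsLocalRing.residue 𝒪[F]), IsLocalRing.residue_eq_zero_iff]
      exact hmem
    have hdvd' : ringChar 𝓀[F] ∣ 3 := (ringChar.spec _ 3).mp h0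
    exact (Nat.prime_dvd_prime_iff_eq (ringChar_residueField_prime (F := F)) Nat.prime_three).mp
      hdvd'
  have hcoe : ∀ σ : absoluteGaloisGroup F, ρ.toMonoidHom σ = ρ σ := fun σ ↦ rfl
  /- Step 1.  If the wild inertia group acts trivially, `ρ̄` is tamely ramified, hence peu
  ramifiée (`I_F^v ⊆ P_F` for `v > 0`). -/
  by_cases hwild : ∀ σ ∈ absWildInertia F ((3 : ℕ) : 𝒪[F]), ρ σ = 1
  · intro v hv σ hσ
    exact hwild σ (absUpperInertia_le_absWildInertia F hϖ0 (one_pos.trans hv) hσ)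
  push Not at hwild
  obtain ⟨σ₀, hσ₀P, hσ₀⟩ := hwild
  /- Step 2.  `ρ̄(P_F)` is a `3`-group, of order `3`, generated by the transvection `g = ρ̄(σ₀)`
  with fixed vector `w₀`. -/
  have hPpow : ∀ σ ∈ absWildInertia F ((3 : ℕ) : 𝒪[F]), ∃ m : ℕ, ρ σ ^ 3 ^ m = 1 := by
    intro σ hσ
    obtain ⟨m, hm⟩ := absWildInertia_pow_mem_of_isOpen F hirr σ hσ ρ.toMonoidHom.ker
      (isOpen_ker ρ)
    refine ⟨m, ?_⟩
    rw [hp3, MonoidHom.mem_ker, map_pow] at hm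
    exact hm
  set H : Subgroup (GL (Fin 2) (ZMod 3)) :=
    (absWildInertia F ((3 : ℕ) : 𝒪[F])).map ρ.toMonoidHom with hHdef
  have hHp : IsPGroup 3 H := by
    rintro ⟨M, hM⟩
    obtain ⟨σ, hσ, rfl⟩ := Subgroup.mem_map.mp hM
    obtain ⟨m, hm⟩ := hPpow σ hσ
    exact ⟨m, Subtype.ext hm⟩
  have hH3 : Nat.card H ≤ 3 := natCard_le_three_of_isPGroup hHp
  obtain ⟨m₀, hm₀⟩ := hPpow σ₀ hσ₀P
  set g : GL (Fin 2) (ZMod 3) := ρ σ₀ with hgdef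
  have hg3 : orderOf g = 3 := orderOf_eq_three_of_pow_eq_one hm₀ hσ₀
  obtain ⟨hN0, hNN⟩ := sub_one_ne_zero_and_mul_self_eq_zero_of_pow_eq_one hm₀ hσ₀
  obtain ⟨w₀, hw₀0, hNw₀⟩ := Serre1972.exists_ne_zero_mulVec_eq_zero hN0 hNN
  have hgw₀ : (g : Matrix (Fin 2) (Fin 2) (ZMod 3)) *ᵥ w₀ = w₀ := by
    have h := hNw₀
    rwa [Matrix.sub_mulVec, Matrix.one_mulVec, sub_eq_zero] at h
  have hgH : g ∈ H := Subgroup.mem_map_of_mem _ hσ₀P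
  have hHg : Subgroup.zpowers g = H := by
    refine Subgroup.eq_of_le_of_card_ge ((Subgroup.zpowers_le).mpr hgH) ?_
    rw [Nat.card_zpowers, hg3]
    exact hH3
  have hPw₀ : ∀ σ ∈ absWildInertia F ((3 : ℕ) : 𝒪[F]),
      (ρ σ : Matrix (Fin 2) (Fin 2) (ZMod 3)) *ᵥ w₀ = w₀ := by
    intro σ hσ
    have hmem : ρ σ ∈ Subgroup.zpowers g := by
      rw [hHg]; exact Subgroup.mem_map_of_mem _ hσ
    rw [← mem_powers_iff_mem_zpowers, Submonoid.mem_powers_iff] at hmem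
    obtain ⟨m, hm⟩ := hmem
    rw [← hm, Units.val_pow_eq_pow_val,
      InertiaShape.pow_mulVec_of_mulVec_eq_smul (c := (1 : ZMod 3))
        (by rw [one_smul]; exact hgw₀) m, one_pow, one_smul]
  /- Step 3.  `P_F ⊴ Γ_F`, so every `ρ̄(σ)` stabilises the line `𝔽₃ w₀`. -/
  haveI hPn : (absWildInertia F ((3 : ℕ) : 𝒪[F])).Normal := absWildInertia_normal F _
  have hline : ∀ σ : absoluteGaloisGroup F, ∃ a : ZMod 3,
      (ρ σ : Matrix (Fin 2) (Fin 2) (ZMod 3)) *ᵥ w₀ = a • w₀ := by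
    intro σ
    have hσ' : σ⁻¹ * σ₀ * σ ∈ absWildInertia F ((3 : ℕ) : 𝒪[F]) := by
      have h := hPn.conj_mem σ₀ hσ₀P σ⁻¹
      rwa [inv_inv] at h
    have hfix := hPw₀ _ hσ'
    refine Serre1972.exists_eq_smul_of_mulVec_eq_zero hN0 hw₀0 hNw₀ ?_
    have hcomm : g * ρ σ = ρ σ * ρ (σ⁻¹ * σ₀ * σ) := by
      rw [hgdef, ← map_mul, ← map_mul, ← mul_assoc, ← mul_assoc, mul_inv_cancel, one_mul]
    rw [Matrix.sub_mulVec, Matrix.one_mulVec, sub_eq_zero, Matrix.mulVec_mulVec, ← Units.val_mul,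
      hcomm, Units.val_mul, ← Matrix.mulVec_mulVec, hfix]
  choose a ha using hline
  /- Step 4.  The basis `(w₀, w₁)`: `f = P⁻¹ ρ̄ P` is upper triangular. -/
  obtain ⟨P, hP⟩ := InertiaShape.exists_gl_mulVec_single_zero_eq w₀ hw₀0
  set f : absoluteGaloisGroup F →* GL (Fin 2) (ZMod 3) :=
    (MulAut.conj P⁻¹).toMonoidHom.comp ρ.toMonoidHom with hfdef
  have hfσ : ∀ σ, f σ = P⁻¹ * ρ σ * P := fun σ ↦ by
    rw [hfdef, MonoidHom.comp_apply, MulEquiv.coe_toMonoidHom, MulAut.conj_apply, inv_inv, hcoe]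
  have hfmat : ∀ σ, ((f σ : GL (Fin 2) (ZMod 3)) : Matrix (Fin 2) (Fin 2) (ZMod 3)) =
      ((P⁻¹ : GL (Fin 2) (ZMod 3)) : Matrix (Fin 2) (Fin 2) (ZMod 3)) *
        (ρ σ : Matrix (Fin 2) (Fin 2) (ZMod 3)) * (P : Matrix (Fin 2) (Fin 2) (ZMod 3)) := fun σ ↦ by
    rw [hfσ, Units.val_mul, Units.val_mul]
  have hfe₀ : ∀ σ, ((f σ : GL (Fin 2) (ZMod 3)) : Matrix (Fin 2) (Fin 2) (ZMod 3)) *ᵥ Pi.single 0 1 =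
      a σ • Pi.single 0 1 := fun σ ↦ by
    rw [hfmat]; exact InertiaShape.conj_mulVec_single_zero hP (ha σ)
  have hf10 : ∀ σ, ((f σ : GL (Fin 2) (ZMod 3)) : Matrix (Fin 2) (Fin 2) (ZMod 3)) 1 0 = 0 :=
    fun σ ↦ by simp [InertiaShape.apply_of_mulVec_single_eq_smul (hfe₀ σ) 1]
  have hf00 : ∀ σ, ((f σ : GL (Fin 2) (ZMod 3)) : Matrix (Fin 2) (Fin 2) (ZMod 3)) 0 0 = a σ :=
    fun σ ↦ by simp [InertiaShape.apply_of_mulVec_single_eq_smul (hfe₀ σ) 0]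
  /- Step 5.  `det ρ̄ = χ̄₃` (Weil pairing) and the diagonal characters `Φ = (a, d)`. -/
  have hWeil : ∀ σ : absoluteGaloisGroup F,
      Matrix.GeneralLinearGroup.det (ρ σ) = modPCyclotomicCharacterZMod F 3 σ :=
    V.det_eq_modPCyclotomicCharacter_of_isTorsionGaloisRep_holds 3 ρ hρ
  have hdet : ∀ σ, ((modPCyclotomicCharacterZMod F 3 σ : (ZMod 3)ˣ) : ZMod 3) =
      ((f σ : GL (Fin 2) (ZMod 3)) : Matrix (Fin 2) (Fin 2) (ZMod 3)) 0 0 *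
        ((f σ : GL (Fin 2) (ZMod 3)) : Matrix (Fin 2) (Fin 2) (ZMod 3)) 1 1 := fun σ ↦ by
    have h1 : Matrix.GeneralLinearGroup.det (f σ) = Matrix.GeneralLinearGroup.det (ρ σ) := by
      rw [hfσ, map_mul, map_mul, map_inv, inv_mul_cancel_comm]
    rw [← hWeil, ← h1, Matrix.GeneralLinearGroup.val_det_apply, Matrix.det_fin_two, hf10, mul_zero,
      sub_zero]
  set Φ : absoluteGaloisGroup F →* (ZMod 3)ˣ × (ZMod 3)ˣ :=
    (InertiaShape.diagChar f hf10 0).prod (InertiaShape.diagChar f hf10 1) with hΦdef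
  have hΦ1 : ∀ σ, ((Φ σ).1 : ZMod 3) =
      ((f σ : GL (Fin 2) (ZMod 3)) : Matrix (Fin 2) (Fin 2) (ZMod 3)) 0 0 := fun σ ↦ rfl
  have hΦ2 : ∀ σ, ((Φ σ).2 : ZMod 3) =
      ((f σ : GL (Fin 2) (ZMod 3)) : Matrix (Fin 2) (Fin 2) (ZMod 3)) 1 1 := fun σ ↦ rfl
  have hΦ_one : ∀ σ, Φ σ = 1 ↔
      ((f σ : GL (Fin 2) (ZMod 3)) : Matrix (Fin 2) (Fin 2) (ZMod 3)) 0 0 = 1 ∧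
        ((f σ : GL (Fin 2) (ZMod 3)) : Matrix (Fin 2) (Fin 2) (ZMod 3)) 1 1 = 1 := fun σ ↦ by
    rw [Prod.ext_iff, Prod.fst_one, Prod.snd_one, Units.ext_iff, Units.ext_iff, hΦ1, hΦ2,
      Units.val_one]
  have hΦχ : ∀ σ, Φ σ = 1 → modPCyclotomicCharacterZMod F 3 σ = 1 := fun σ h ↦ by
    obtain ⟨h0, h1⟩ := (hΦ_one σ).mp h
    exact Units.ext (by rw [hdet, h0, h1, mul_one, Units.val_one])
  -- `ker ρ̄ ≤ ker Φ`, so `ker Φ` is open; `P_F ≤ ker Φ`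
  have hkerρ : ρ.toMonoidHom.ker ≤ Φ.ker := fun σ hσ ↦ by
    rw [MonoidHom.mem_ker] at hσ ⊢
    rw [hcoe] at hσ
    have hf1 : f σ = 1 := by rw [hfσ, hσ, mul_one, inv_mul_cancel]
    rw [hΦ_one, hf1, Units.val_one, Matrix.one_apply_eq, Matrix.one_apply_eq]
    exact ⟨rfl, rfl⟩
  have hΦopen : IsOpen (Φ.ker : Set (absoluteGaloisGroup F)) :=
    Subgroup.isOpen_mono hkerρ (isOpen_ker ρ)
  have hPΦ : absWildInertia F ((3 : ℕ) : 𝒪[F]) ≤ Φ.ker := fun σ hσ ↦ by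
    obtain ⟨m, hm⟩ := absWildInertia_pow_mem_of_isOpen F hirr σ hσ _ (isOpen_ker ρ)
    rw [hp3] at hm
    have h1 : Φ σ ^ 3 ^ m = 1 := by rw [← map_pow]; exact hkerρ hm
    rw [MonoidHom.mem_ker, ← units_prod_pow_three_pow (Φ σ) m, h1]
  /- Step 6.  `I_F / P_F` is pro-cyclic: `Φ(I_F)` has at most one non-trivial element. -/
  let U : OpenNormalSubgroup (absoluteGaloisGroup F) :=
    { toSubgroup := Φ.ker, isOpen' := hΦopen, isNormal' := inferInstance }
  obtain ⟨hcyc, -⟩ := isCyclic_map_absInertia_of_absWildInertia_le F hϖ0 U hPΦ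
  haveI : Finite (absoluteGaloisGroup F ⧸ Φ.ker) :=
    Finite.of_equiv _ (QuotientGroup.quotientKerEquivRange Φ).symm.toEquiv
  have hclaim : ∀ τ ∈ absInertia F, ∀ τ' ∈ absInertia F, Φ τ ≠ 1 → Φ τ' ≠ 1 → Φ τ = Φ τ' := by
    intro τ hτ τ' hτ' h1 h1'
    set C : Subgroup (absoluteGaloisGroup F ⧸ Φ.ker) :=
      (absInertia F).map (QuotientGroup.mk' Φ.ker) with hCdef
    haveI : IsCyclic C := hcyc
    have hsq : ∀ σ : absoluteGaloisGroup F, (QuotientGroup.mk' Φ.ker σ) ^ 2 = 1 := fun σ ↦ by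
      rw [← map_pow, QuotientGroup.mk'_apply, QuotientGroup.eq_one_iff, MonoidHom.mem_ker, map_pow]
      exact units_prod_sq _
    have hne : ∀ σ : absoluteGaloisGroup F, Φ σ ≠ 1 → QuotientGroup.mk' Φ.ker σ ≠ 1 :=
      fun σ hσ h ↦ by
        rw [QuotientGroup.mk'_apply, QuotientGroup.eq_one_iff, MonoidHom.mem_ker] at h
        exact hσ h
    have key := eq_of_sq_eq_one_of_isCyclic (C := C)
      (x := ⟨QuotientGroup.mk' Φ.ker τ, Subgroup.mem_map_of_mem _ hτ⟩)
      (y := ⟨QuotientGroup.mk' Φ.ker τ', Subgroup.mem_map_of_mem _ hτ'⟩)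
      (Subtype.ext (hsq τ)) (Subtype.ext (hsq τ')) (fun h ↦ hne τ h1 (congrArg Subtype.val h))
      (fun h ↦ hne τ' h1' (congrArg Subtype.val h))
    have h := congrArg Subtype.val key
    simp only at h
    rw [QuotientGroup.mk'_apply, QuotientGroup.mk'_apply, QuotientGroup.eq, MonoidHom.mem_ker,
      map_mul, map_inv, inv_mul_eq_one] at h
    exact h
  -- an inertia element on which `χ̄₃ = -1` (the extension `F(ζ₃)/F` is ramified)
  obtain ⟨τ₁, hτ₁I, hχτ₁⟩ :=
    exists_mem_absInertia_modPCyclotomicCharacterZMod_eq (F := F) hirr hq (-1)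
  have hΦτ₁ : Φ τ₁ ≠ 1 := fun h ↦ by
    have h' := Units.ext_iff.mp (hΦχ τ₁ h)
    rw [hχτ₁, Units.val_neg, Units.val_one] at h'
    exact absurd h' (by decide)
  have hI : ∀ τ ∈ absInertia F,
      (Φ τ = 1 ∧ modPCyclotomicCharacterZMod F 3 τ = 1) ∨
        (Φ τ = Φ τ₁ ∧ modPCyclotomicCharacterZMod F 3 τ = -1) := by
    intro τ hτ
    by_cases h : Φ τ = 1
    · exact Or.inl ⟨h, hΦχ τ h⟩
    · have hΦeq := hclaim τ hτ τ₁ hτ₁I h hΦτ₁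
      refine Or.inr ⟨hΦeq, ?_⟩
      rw [← hχτ₁]
      apply Units.ext
      rw [hdet, hdet, ← hΦ1, ← hΦ2, ← hΦ1, ← hΦ2, hΦeq]
  /- Step 7.  Radical data `ζ₃, ∛Δ, R₀, R₁, R₂` for `E[3]`, fixed by `ker ρ̄`. -/
  have h2F : (2 : F) ≠ 0 := two_ne_zero
  have h3F : (3 : F) ≠ 0 := three_ne_zero
  have h3' : (3 : AlgebraicClosure F) ≠ 0 := three_ne_zero
  obtain ⟨-, ec₄, ec₆, eΔ⟩ := V.baseChange_algebraicClosure_invariants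
  obtain ⟨ζ, δ, R₀, R₁, R₂, hζ, hδ, h₀, h₁, h₂, hR⟩ :=
    (V.baseChange (AlgebraicClosure F)).exists_radical
  rw [eΔ] at hδ
  rw [ec₄] at h₀ h₁ h₂
  rw [ec₆] at hR
  have hfixX : ∀ σ : absoluteGaloisGroup F, ρ σ = 1 → σ ∈ V.xFixingSubgroup 3 := fun σ hσ ↦
    V.fixingSubgroupOfModule_le_xFixingSubgroup 3
      ((V.mem_fixingSubgroupOfModule_geomTorsion_iff 3).mpr ((hρ.apply_eq_one_iff' σ).mp hσ))
  obtain ⟨hζX, hδX⟩ := V.zeta_mem_and_delta_mem_xDivisionField_three h2F h3F hζ hδ h₀ h₁ h₂ hR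
  rw [xDivisionField_def, IntermediateField.mem_fixedField_iff] at hζX hδX
  have hζfix : ∀ σ : absoluteGaloisGroup F, ρ σ = 1 → σ • ζ = ζ := fun σ hσ ↦ hζX σ (hfixX σ hσ)
  have hδfix : ∀ σ : absoluteGaloisGroup F, ρ σ = 1 → σ • δ = δ := fun σ hσ ↦ hδX σ (hfixX σ hσ)
  obtain ⟨hζ1, -, -⟩ := ne_of_sq_add_self_add_one h3' hζ
  have hζ3 : ζ ^ 3 = 1 := by linear_combination (ζ - 1) * hζ
  have hζprim : IsPrimitiveRoot ζ 3 := isPrimitiveRoot_three_of_cube_eq_one hζ3 hζ1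
  have hδ0 : δ ≠ 0 := by
    intro h0
    rw [h0, zero_pow three_ne_zero, eq_comm, map_eq_zero] at hδ
    exact (V.coe_Δ' ▸ V.Δ'.ne_zero : V.Δ ≠ 0) hδ
  /- Step 8.  The criterion. -/
  refine isPeuRamifie_of_forall_exists_algNorm_le ρ hp3 hirr ?_ ?_
  · /- `#ρ̄(I_F) ≤ 6`: `M ↦ (det M, (P⁻¹ M P)₀₁)` is injective on `ρ̄(I_F)`. -/
    let ψ : (absInertia F).map ρ.toMonoidHom → (ZMod 3)ˣ × ZMod 3 := fun x ↦
      (Matrix.GeneralLinearGroup.det x.1,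
        ((P⁻¹ * x.1 * P : GL (Fin 2) (ZMod 3)) : Matrix (Fin 2) (Fin 2) (ZMod 3)) 0 1)
    have hψ : Function.Injective ψ := by
      rintro ⟨M₁, hM₁⟩ ⟨M₂, hM₂⟩ h
      obtain ⟨τ, hτ, rfl⟩ := Subgroup.mem_map.mp hM₁
      obtain ⟨τ', hτ', rfl⟩ := Subgroup.mem_map.mp hM₂
      simp only [ψ, Prod.mk.injEq, hcoe] at h
      obtain ⟨hd, hc⟩ := h
      rw [hWeil, hWeil] at hd
      rw [← hfσ, ← hfσ] at hc
      have hΦeq : Φ τ = Φ τ' := by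
        rcases hI τ hτ with ⟨e1, hχ1⟩ | ⟨e1, hχ1⟩ <;> rcases hI τ' hτ' with ⟨e2, hχ2⟩ | ⟨e2, hχ2⟩
        · rw [e1, e2]
        · exfalso
          have hd' := Units.ext_iff.mp hd
          rw [hχ1, hχ2, Units.val_neg, Units.val_one] at hd'
          exact absurd hd' (by decide)
        · exfalso
          have hd' := Units.ext_iff.mp hd
          rw [hχ1, hχ2, Units.val_neg, Units.val_one] at hd'
          exact absurd hd' (by decide)
        · rw [e1, e2]
      have hfeq : ((f τ : GL (Fin 2) (ZMod 3)) : Matrix (Fin 2) (Fin 2) (ZMod 3)) =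
          ((f τ' : GL (Fin 2) (ZMod 3)) : Matrix (Fin 2) (Fin 2) (ZMod 3)) := by
        rw [InertiaShape.eq_of_diagChar f hf10 τ, InertiaShape.eq_of_diagChar f hf10 τ']
        have e0 : InertiaShape.diagChar f hf10 0 τ = InertiaShape.diagChar f hf10 0 τ' :=
          congrArg Prod.fst hΦeq
        have e1 : InertiaShape.diagChar f hf10 1 τ = InertiaShape.diagChar f hf10 1 τ' :=
          congrArg Prod.snd hΦeq
        rw [e0, e1, hc]
      have hfeq' : f τ = f τ' := Units.ext hfeq
      rw [hfσ, hfσ] at hfeq'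
      apply Subtype.ext
      simp only [hcoe]
      exact mul_left_cancel (mul_right_cancel hfeq')
    calc Nat.card ((absInertia F).map ρ.toMonoidHom) ≤ Nat.card ((ZMod 3)ˣ × ZMod 3) :=
          Nat.card_le_card_of_injective ψ hψ
      _ = 3 * (3 - 1) := by
          rw [Nat.card_prod, Nat.card_zmod, Nat.card_eq_fintype_card, ZMod.card_units]
  · /- the Kummer witnesses -/
    intro τ hτI hρτ
    rcases hI τ hτI with ⟨hΦτ, hχτ⟩ | ⟨-, hχτ⟩
    · /- `ρ̄(τ)` unipotent, `≠ 1`: witness `x = ∛Δ / c` -/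
      obtain ⟨c, hc⟩ := hΔ
      have hΔ0 : algNorm F (algebraMap F (AlgebraicClosure F) V.Δ) ≠ 0 := by
        rw [Ne, algNorm_eq_zero_iff, map_eq_zero]
        exact (V.coe_Δ' ▸ V.Δ'.ne_zero : V.Δ ≠ 0)
      have hc0 : algNorm F (algebraMap F (AlgebraicClosure F) c) ≠ 0 := by
        intro h; rw [h, zero_pow three_ne_zero] at hc; exact hΔ0 hc
      have hδc : algNorm F δ = algNorm F (algebraMap F (AlgebraicClosure F) c) := by
        have h : algNorm F δ ^ 3 = algNorm F (algebraMap F (AlgebraicClosure F) c) ^ 3 := by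
          rw [← algNorm_pow, hδ, hc]
        exact (pow_left_inj₀ (algNorm_nonneg _) (algNorm_nonneg _) three_ne_zero).mp h
      have hx1 : algNorm F (δ * (algebraMap F (AlgebraicClosure F) c)⁻¹) = 1 := by
        rw [algNorm_mul, algNorm_inv, hδc, mul_inv_cancel₀ hc0]
      -- `τ` fixes `ζ₃` and the line `𝔽₃ w₀`, hence moves `∛Δ` (radical rigidity)
      have hτζ : τ • ζ = ζ := by
        have hv : ((1 : (ZMod 3)ˣ) : ZMod 3).val = 1 := by decide
        rw [modPCyclotomicCharacterZMod_spec F 3 τ ζ hζ3, hχτ, hv, pow_one]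
      have haτ : a τ = 1 := by rw [← hf00]; exact ((hΦ_one τ).mp hΦτ).1
      have hρτw₀ : (ρ τ : Matrix (Fin 2) (Fin 2) (ZMod 3)) *ᵥ w₀ = w₀ := by
        rw [ha, haτ, one_smul]
      obtain ⟨e, he⟩ := id hρ
      have hT0 : e.symm w₀ ≠ 0 := fun h ↦
        hw₀0 (by rw [← e.apply_symm_apply w₀, h, map_zero])
      have hτT : τ • e.symm w₀ = e.symm w₀ :=
        e.injective (by rw [he, AddEquiv.apply_symm_apply, hρτw₀])
      have hτδ : τ • δ ≠ δ := by
        intro hτδ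
        have hτX := V.mem_xFixingSubgroup_three_of_smul_eq_self hζ hδ h₀ h₁ h₂ hR hτζ hτδ hT0
          (Or.inl hτT)
        rcases hρ.apply_eq_one_or_eq_neg_one_of_mem_xFixingSubgroup hτX with h | h
        · exact hρτ h
        · have h00 := ((hΦ_one τ).mp hΦτ).1
          rw [hfmat, h, Units.val_neg, Units.val_one, mul_neg, mul_one, neg_mul, ← Units.val_mul,
            inv_mul_cancel, Units.val_one, Matrix.neg_apply, Matrix.one_apply_eq] at h00
          exact absurd h00 (by decide)
      -- `η = τ(∛Δ)/∛Δ` is a primitive cube root of unity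
      have hτδ' : τ • δ = (τ • δ * δ⁻¹) * δ := by rw [inv_mul_cancel_right₀ hδ0]
      have hη3 : (τ • δ * δ⁻¹) ^ 3 = 1 := by
        rw [mul_pow, ← smul_pow', hδ, smul_algebraMap, ← hδ, inv_pow,
          mul_inv_cancel₀ (pow_ne_zero 3 hδ0)]
      have hη1 : τ • δ * δ⁻¹ ≠ 1 := fun h ↦ hτδ (by rw [hτδ', h, one_mul])
      have hηprim : IsPrimitiveRoot (τ • δ * δ⁻¹) 3 := isPrimitiveRoot_three_of_cube_eq_one hη3 hη1
      refine ⟨δ * (algebraMap F (AlgebraicClosure F) c)⁻¹, fun σ hσ ↦ ?_, hx1.le, ?_⟩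
      · rw [smul_mul', smul_inv'', smul_algebraMap, hδfix σ hσ]
      · have hτx : τ • (δ * (algebraMap F (AlgebraicClosure F) c)⁻¹) -
            δ * (algebraMap F (AlgebraicClosure F) c)⁻¹ =
            -(1 - τ • δ * δ⁻¹) * (δ * (algebraMap F (AlgebraicClosure F) c)⁻¹) := by
          rw [smul_mul', smul_inv'', smul_algebraMap]
          nth_rewrite 1 [hτδ']
          ring
        rw [map_natCast, hτx, algNorm_mul, algNorm_neg, hx1, mul_one,
          algNorm_one_sub_primitiveRoot_pow hηprim]
    · /- `χ̄₃(τ) = -1`: witness `x = ζ₃`, `τ ζ₃ = ζ₃²` -/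
      have hζn : algNorm F ζ = 1 :=
        Literature.NumberTheory.GaloisRepresentations.algNorm_eq_one_of_pow_eq_one three_ne_zero hζ3
      refine ⟨ζ, hζfix, hζn.le, ?_⟩
      have hτζ : τ • ζ = ζ ^ 2 := by
        have hv : ((-1 : (ZMod 3)ˣ) : ZMod 3).val = 2 := by decide
        rw [modPCyclotomicCharacterZMod_spec F 3 τ ζ hζ3, hχτ, hv]
      have e1 : τ • ζ - ζ = ζ * -(1 - ζ) := by rw [hτζ]; ring
      rw [map_natCast, e1, algNorm_mul, hζn, one_mul, algNorm_neg,
        algNorm_one_sub_primitiveRoot_pow hζprim]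

end Local

section Rat

/-- **`E/ℚ` with `3 ∣ v₃(Δ)`: `(ρ̄_{E,3} ⊗ k)|Γ_F` is peu ramifiée** for every `3`-adic field
`F ⊇ ℚ` with residue field `𝔽₃` and uniformiser `3` (the fields of the tree's local restriction
data `ModPGaloisRep.LocalRestrictionAt 3`), every framing `ρ̄` of `E[3]` over `ℚ` and every
coefficient extension `j : 𝔽₃ → k`.  Hypothesis: `Δ_E = D ∈ ℤ` with `3 ∣ v₃(D)` — e.g. a global
minimal model of Kodaira type III (`v₃(Δ_min) = 3`) or III* (`v₃(Δ_min) = 9`) at `3`, the two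
wild rows of the tame quartic class (CDT 1999, proof of Thm. 7.2.1), or `I_{3n}`, or good
reduction at `3`.
[cite: ConradDiamondTaylor1999, §7.2, proof of Thm. 7.2.1 (p. 553)] [cite: Serre1987, §2.4] -/
theorem isPeuRamifie_restrictField_three_of_dvd_padicValInt (W : WeierstrassCurve ℚ)
    [W.IsElliptic] {D : ℤ} (hD : W.Δ = D) (h3D : 3 ∣ padicValInt 3 D)
    (F : Type) [Field F] [ValuativeRel F] [TopologicalSpace F] [IsNonarchimedeanLocalField F]
    [Algebra ℚ F] (hq : residueFieldCard F = 3) (hirr : Irreducible ((3 : ℕ) : 𝒪[F]))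
    {ρ : ModPGaloisRep ℚ (ZMod 3) 2} (hρ : W.IsTorsionGaloisRep 3 ρ)
    {k : Type} [Field k] [TopologicalSpace k] [DiscreteTopology k] (j : ZMod 3 →+* k)
    (hj : Continuous j) :
    ModPGaloisRep.IsPeuRamifie
      (FramedGaloisRep.restrictField F (FramedRep.baseChange j hj ρ) : ModPGaloisRep F k 2) := by
  haveI : CharZero F := charZero_of_injective_algebraMap (algebraMap ℚ F).injective
  /- Step A: it suffices to treat `ρ̄|Γ_F` itself. -/
  suffices hF : ModPGaloisRep.IsPeuRamifie
      (FramedGaloisRep.restrictField F ρ : ModPGaloisRep F (ZMod 3) 2) by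
    intro u hu σ hσ
    have h1 : ρ (absGaloisRestrict ℚ F σ) = 1 := hF u hu σ hσ
    apply Units.ext
    rw [FramedGaloisRep.restrictField_apply, FramedRep.coe_baseChange_apply, h1, Units.val_one,
      Units.val_one, Matrix.map_one j (map_zero j) (map_one j)]
  /- Step B: `‖Δ‖ = ‖3^m‖³` in `F̄`, and the local theorem for `E⁄F`. -/
  refine (W.baseChange F).isPeuRamifie_three_of_algNorm_Δ_eq_cube hirr hq ?_
    (hρ.restrictField three_ne_zero F)
  have hΔ0 : W.Δ ≠ 0 := (W.coe_Δ' ▸ W.Δ'.ne_zero : W.Δ ≠ 0)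
  have hD0 : D ≠ 0 := by rintro rfl; rw [Int.cast_zero] at hD; exact hΔ0 hD
  obtain ⟨v, hv⟩ : ∃ v : ℕ, padicValInt 3 D = v := ⟨_, rfl⟩
  obtain ⟨m, hm⟩ := h3D
  obtain ⟨n, hn⟩ : (3 : ℤ) ^ v ∣ D := by
    have h := (padicValInt_dvd_iff v D (p := 3)).mpr (Or.inr hv.ge)
    exact_mod_cast h
  have hn3 : ¬ (3 : ℤ) ∣ n := by
    rintro ⟨n', rfl⟩
    have h : ((3 : ℕ) : ℤ) ^ (v + 1) ∣ D := ⟨n', by rw [hn]; push_cast; ring⟩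
    rcases (padicValInt_dvd_iff _ _).mp h with h | h
    · exact hD0 h
    · omega
  have hΔF : (W.baseChange F).Δ = algebraMap ℚ F W.Δ := W.map_Δ _
  have hlt : algNorm F ((3 : ℕ) : AlgebraicClosure F) < 1 := algNorm_natCast_lt_one hirr
  have hn1 : algNorm F ((n : ℤ) : AlgebraicClosure F) = 1 :=
    algNorm_intCast_eq_one_of_not_dvd Nat.prime_three hlt (by exact_mod_cast hn3)
  have hDcast : ((D : ℤ) : AlgebraicClosure F) =
      (3 : AlgebraicClosure F) ^ (m * 3) * (n : AlgebraicClosure F) := by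
    rw [hn, ← hv, hm, mul_comm 3 m]; push_cast; ring
  refine ⟨(3 : F) ^ m, ?_⟩
  rw [hΔF, hD, map_intCast, map_intCast, hDcast, algNorm_mul, hn1, mul_one, map_pow, map_ofNat,
    algNorm_pow, algNorm_pow, pow_mul]

/-- The same statement at an arbitrary local restriction datum of `ρ̄_{E,3} ⊗_j k` at `3`
(`ModPGaloisRep.LocalRestrictionAt`), the shape consumed by Serre's recipe `serreWeight 3`.
[cite: ConradDiamondTaylor1999, §7.2, proof of Thm. 7.2.1 (p. 553)] [cite: Serre1987, §2.4] -/
theorem isPeuRamifie_localRestrictionAt_three_of_dvd_padicValInt (W : WeierstrassCurve ℚ)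
    [W.IsElliptic] {D : ℤ} (hD : W.Δ = D) (h3D : 3 ∣ padicValInt 3 D)
    {ρ : ModPGaloisRep ℚ (ZMod 3) 2} (hρ : W.IsTorsionGaloisRep 3 ρ)
    {k : Type} [Field k] [TopologicalSpace k] [DiscreteTopology k] (j : ZMod 3 →+* k)
    (hj : Continuous j) (loc : ModPGaloisRep.LocalRestrictionAt 3 (FramedRep.baseChange j hj ρ)) :
    loc.rep.IsPeuRamifie := by
  rw [loc.rep_eq_restrictField]
  exact W.isPeuRamifie_restrictField_three_of_dvd_padicValInt hD h3D loc.F loc.residueFieldCard_eq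
    loc.irreducible_natCast hρ j hj

/-- **Case A of Serre weight two at `3`.**  For `E/ℚ` with `Δ_E = D ∈ ℤ`, `3 ∣ v₃(D)`: at any local
restriction datum `loc` of `ρ̄_{E,3} ⊗_j k` at `3` and residue embedding `ι`, if `ρ̄|I_F` has the
level-one shape `(χ *; 0 1)` then `k(ρ̄) = 2` — Serre's case (2.8.2), the alternative "tame or peu
ramifiée" being settled by `isPeuRamifie_localRestrictionAt_three_of_dvd_padicValInt`.  (For a très
ramifiée `(χ *; 0 1)` the recipe would give `k = p + 1 = 4`.)
[cite: Serre1987, §2.8 Prop. 3 (2.8.2) and §2.4 (ii)] [cite: ConradDiamondTaylor1999, §7.2, proof of Thm. 7.2.1 (p. 553)] -/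
theorem serreWeight_three_eq_two_of_hasLevelOneInertiaShape_of_dvd_padicValInt
    (W : WeierstrassCurve ℚ) [W.IsElliptic] {D : ℤ} (hD : W.Δ = D) (h3D : 3 ∣ padicValInt 3 D)
    {ρ : ModPGaloisRep ℚ (ZMod 3) 2} (hρ : W.IsTorsionGaloisRep 3 ρ)
    {k : Type} [Field k] [TopologicalSpace k] [DiscreteTopology k] (j : ZMod 3 →+* k)
    (hj : Continuous j) (loc : ModPGaloisRep.LocalRestrictionAt 3 (FramedRep.baseChange j hj ρ))
    (ι : absIntegers 𝒪[loc.F] loc.F ⧸ absMaximalIdeal loc.F →+* k)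
    (hshape : loc.rep.HasLevelOneInertiaShape ι ((3 : ℕ) : 𝒪[loc.F]) loc.irreducible_natCast 1 0) :
    ModPGaloisRep.serreWeight 3 (FramedRep.baseChange j hj ρ) loc ι = 2 :=
  ModPGaloisRep.serreWeight_eq_two_of_shape loc ι (by norm_num)
    (Or.inr ⟨hshape, Or.inr
      (W.isPeuRamifie_localRestrictionAt_three_of_dvd_padicValInt hD h3D hρ j hj loc)⟩)

/-- **Case A of Serre weight six at `3`.**  For `E/ℚ` with `Δ_E = D ∈ ℤ`, `3 ∣ v₃(D)`: at any
local restriction datum `loc` of `ρ̄_{E,3} ⊗_j k` at `3` and residue embedding `ι`, if `ρ̄|Γ_F` is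
wildly ramified with level-one shape `(1 *; 0 χ) = (χ² *; 0 χ)` then `k(ρ̄) = 6 = 2·3` — Serre's
case (2.4.8) (`β = α + 1 = 2`, peu ramifiée by
`isPeuRamifie_localRestrictionAt_three_of_dvd_padicValInt`; a très ramifiée `(1 *; 0 χ)` would
give `k = (α + 1)(q + 1) = 8`).
[cite: Serre1987, §2.4 (ii₁) (2.4.8)] [cite: ConradDiamondTaylor1999, Conj. 1.2.3 and §7.2, proof of Thm. 7.2.1 (p. 553)] -/
theorem serreWeight_three_eq_six_of_hasLevelOneInertiaShape_of_dvd_padicValInt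
    (W : WeierstrassCurve ℚ) [W.IsElliptic] {D : ℤ} (hD : W.Δ = D) (h3D : 3 ∣ padicValInt 3 D)
    {ρ : ModPGaloisRep ℚ (ZMod 3) 2} (hρ : W.IsTorsionGaloisRep 3 ρ)
    {k : Type} [Field k] [TopologicalSpace k] [DiscreteTopology k] (j : ZMod 3 →+* k)
    (hj : Continuous j) (loc : ModPGaloisRep.LocalRestrictionAt 3 (FramedRep.baseChange j hj ρ))
    (ι : absIntegers 𝒪[loc.F] loc.F ⧸ absMaximalIdeal loc.F →+* k)
    (hw : ¬ loc.rep.IsTamelyRamified)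
    (hshape : loc.rep.HasLevelOneInertiaShape ι ((3 : ℕ) : 𝒪[loc.F]) loc.irreducible_natCast 2 1) :
    ModPGaloisRep.serreWeight 3 (FramedRep.baseChange j hj ρ) loc ι = 6 := by
  have hpeu := W.isPeuRamifie_localRestrictionAt_three_of_dvd_padicValInt hD h3D hρ j hj loc
  have hq : residueFieldCard loc.F = 3 := loc.residueFieldCard_eq
  have hshape' : loc.rep.HasLevelOneInertiaShape ι ((3 : ℕ) : 𝒪[loc.F]) loc.irreducible_natCast
      (residueFieldCard loc.F - 1) 1 := by
    rw [hq]; exact hshape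
  show loc.rep.serreWeightLocal ι = 6
  rw [ModPGaloisRep.serreWeightLocal_eq_two_mul_residueFieldCard (by rw [hq]; decide) hw hpeu
    loc.irreducible_natCast hshape', hq]

end Rat

end WeierstrassCurve

end
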